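import Summits.NavierStokesRegularity.NavierStokesRegularity.Theorems.IntenseSetDoorsTwistDefs
import Summits.NavierStokesRegularity.NavierStokesRegularity.Theorems.IntenseSetDoorsTwistTools
import Literature.Analysis.FluidPDE.TaoLocalisationProofs
import HarnessLib

/-!
# S34 «IntenseSetDoors» — plate A34-D «CriticalTwistPowerBoundAssembly» PROVED (door D «CriticalTwistDoor»)

Summits-side proof file (theorems only) for door S34-D (texts `Theorems/IntenseSetDoorsTwistDefs.lean`, the
LEAD's draft adopted verbatim by the planner of record nsreg-p1 g29, 2026-08-28):
`criticalTwistPowerBoundAssembly_holds : CriticalTwistPowerBoundAssembly`, i.e.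
`ValueCutoffLowStretching → LambPairingBound → ForcedPowerGronwallSlab → CriticalTwistPowerBound`,
BY NAME (V34, L34, G34 are HYPOTHESES here).

Proof (skeleton = A34-A): given `ε₀`, `η := (√3/(4ε₀) − 1)/2`, `a₀ := (2/√3)(1+η)ε₀ < 1/2`, `C = C_η`
from L34, `K₆` the tree's `H¹ ⊂ L⁶` constant, `ε₃ := √(1/2 − a₀)/(C K₆ + 1)`. At a slab time `s`, level
`L := ε₀/(T − s)`, radius `m := ε₃√(ν/(T − s))`: the engine `two_mul_integral_stretching_le_lamb` gives
`2∫⟪ω,(∇u)ω⟫ ≤ (a₀/(T − s))∫|ω|² + C√D√Λ`; `setIntegral_cross_sq_le_of_twist` gives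
`Λ ≤ (mK₆)²∫‖∇u‖² ≤ (mK₆)²∫|ω|²`; `young_twist` gives `C√D√Λ ≤ νD + ((CK₆ε₃)²/4)(T − s)^{−1}∫|ω|²`; so G34
applies with `a = a₀ + (CK₆ε₃)²/4 < 1/2`, `β = 0`; output conversion and time translation as in A34-A.
HONEST FRAME: V34/L34/G34 are hypotheses by name; S34-D is a regularity CRITERION (small critical
perpendicular-to-`u` vorticity on the intense core ⇒ continuation); 0056 `NoTypeII` / NS regularity NOT
proved.
-/

noncomputable section

set_option linter.dupNamespace false

open MeasureTheory Set Function Filter Metric Real InnerProductSpace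
open _root_.Topology
open scoped ENNReal NNReal RealInnerProductSpace ContDiff
open Literature.Analysis Literature.Analysis.FluidPDE
open Summit.NavierStokesRegularity.NavierStokesRegularity.Theorems.CriticalCoherenceDoor
  (SubcriticalEnstrophyContinuation exponent_of_lt_sqrt_three_div_four)

namespace Summit.NavierStokesRegularity.NavierStokesRegularity.Theorems.IntenseSetDoors

-- nested operator types (second derivatives)
set_option maxSynthPendingDepth 3

/-! ### §3 Plate A34-D -/

/-- **A34-D at `t₀ = 0`.** Let `ν > 0`, `T > 0`, `0 < ε₀ < √3/4`, `ε₃ > 0`, and let `C ≥ 0` be a Lamb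
pairing constant at width `η = (√3/(4ε₀) − 1)/2` with `(C K₆ ε₃)² ≤ 1/2 − a₀`,
`a₀ = (2/√3)(1+η)ε₀`. For a classical unforced Navier–Stokes solution on `ℝ³ × [0, T)` with all `L²`
Sobolev seminorms bounded on every `[0, T'']`, `T'' < T`, satisfying `CriticalTwist u ν T 0 ε₀ ε₃`,
the plates V34 and G34 give `∫⁻|∇u(t)|²_F ≤ K(T − t)^{−a}` on `[0, T)`, `a = a₀ + (C K₆ ε₃)²/4 < 1/2`.
[folklore] -/
theorem criticalTwistPowerBound_zero (hV : ValueCutoffLowStretching) (hGr : ForcedPowerGronwallSlab)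
    {ν T ε₀ ε₃ C : ℝ} (hν : 0 < ν) (hTpos : 0 < T) (hε₀ : 0 < ε₀) (hε₀' : ε₀ < Real.sqrt 3 / 4)
    (hε₃ : 0 < ε₃) (hC0 : 0 ≤ C)
    (hC : ∀ (L : ℝ), 0 < L →
      ∀ ⦃v : (EuclideanSpace ℝ (Fin 3)) → (EuclideanSpace ℝ (Fin 3))⦄ (_ : ContDiff ℝ 2 v)
        (_ : VectorCalculus.IsDivFree v)
        (_ : Integrable fun x => ‖v x‖ ^ 2) (_ : Integrable fun x => ‖fderiv ℝ v x‖ ^ 2)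
        (_ : Integrable fun x => ‖fderiv ℝ (fderiv ℝ v) x‖ ^ 2)
        (_ : ∃ B : ℝ, ∀ x, ‖fderiv ℝ (fderiv ℝ v) x‖ ≤ B),
        2 * ∫ x, (1 - radialCutoff L ((1 + (Real.sqrt 3 / (4 * ε₀) - 1) / 2) * L) (curl v x)) *
            ⟪curl v x, fderiv ℝ v x (curl v x)⟫ ≤
          C * Real.sqrt (∫ x, frobeniusNormSq (fderiv ℝ (curl v) x)) *
            Real.sqrt (∫ x in {x | L < ‖curl v x‖}, ‖cross (v x) (curl v x)‖ ^ 2))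
    (hsmall : (C * (SNormLESNormFDerivOfEqConst (EuclideanSpace ℝ (Fin 3))
      (volume : Measure (EuclideanSpace ℝ (Fin 3))) 2 : ℝ) * ε₃) ^ 2 ≤
        1 / 2 - 2 / Real.sqrt 3 * (1 + (Real.sqrt 3 / (4 * ε₀) - 1) / 2) * ε₀)
    {u : ℝ → (EuclideanSpace ℝ (Fin 3)) → (EuclideanSpace ℝ (Fin 3))}
    {p : ℝ → (EuclideanSpace ℝ (Fin 3)) → ℝ}
    (hsol : IsClassicalNSSolutionOn (Ico 0 T) ν 0 u p)
    (hreg : ∀ T'' < T, HasBoundedSobolevNormsOn (Icc 0 T'') u)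
    (htw : CriticalTwist u ν T 0 ε₀ ε₃) :
    ∃ K a : ℝ, 0 ≤ K ∧ a < 1 / 2 ∧ ∀ t ∈ Ico 0 T,
      (∫⁻ x, ENNReal.ofReal (frobeniusNormSq (fderiv ℝ (u t) x))) ≤
        ENNReal.ofReal (K * (T - t) ^ (-a)) := by
  set K₆ : ℝ := (SNormLESNormFDerivOfEqConst (EuclideanSpace ℝ (Fin 3))
    (volume : Measure (EuclideanSpace ℝ (Fin 3))) 2 : ℝ) with hK₆
  have hK₆0 : 0 ≤ K₆ := NNReal.coe_nonneg _
  obtain ⟨hη, ha00, ha0⟩ := exponent_of_lt_sqrt_three_div_four hε₀ hε₀'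
  set η : ℝ := (Real.sqrt 3 / (4 * ε₀) - 1) / 2 with hηdef
  set a₀ : ℝ := 2 / Real.sqrt 3 * (1 + η) * ε₀ with ha₀def
  set k : ℝ := C * K₆ * ε₃ with hkdef
  have hk0 : 0 ≤ k := by positivity
  set a : ℝ := a₀ + k ^ 2 / 4 with hadef
  have ha_nonneg : 0 ≤ a := add_nonneg ha00 (by positivity)
  have ha : a < 1 / 2 := by
    have hk2 : k ^ 2 ≤ 1 / 2 - a₀ := hsmall
    rw [hadef]
    nlinarith [hk2, ha0, sq_nonneg k]
  set Y₀ : ℝ := ∫ x, ‖curl (u 0) x‖ ^ 2 with hY₀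
  have hY₀0 : 0 ≤ Y₀ := integral_nonneg fun x => sq_nonneg _
  have hTa : 0 ≤ T ^ a := Real.rpow_nonneg hTpos.le _
  refine ⟨Y₀ * T ^ a, a, mul_nonneg hY₀0 hTa, ha, ?_⟩
  intro t ht
  -- a closed slab containing `t`
  set T'' : ℝ := (t + T) / 2 with hT''def
  have htT'' : t < T'' := by rw [hT''def]; linarith [ht.2]
  have hT''T : T'' < T := by rw [hT''def]; linarith [ht.2]
  have hT''pos : 0 < T'' := lt_of_le_of_lt ht.1 htT''
  have hS : IsClassicalNSSolutionOn (Icc 0 T'') ν 0 u p :=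
    hsol.mono (Icc_subset_Ico_right hT''T) (uniqueDiffOn_Icc hT''pos)
  have hB : HasBoundedSobolevNormsOn (Icc 0 T'') u := hreg T'' hT''T
  have htS : t ∈ Icc 0 T'' := ⟨ht.1, htT''.le⟩
  obtain ⟨B₁, B₂, -, -, hpk⟩ := slice_package hS hB
  obtain ⟨B₀, hB₀⟩ := linfty_bound_of_hasBoundedSobolevNormsOn_holds
    (fun r hr => (hS.contDiff_velocity hr).of_le (by norm_cast)) hB
  -- the stretching inequality on the slab (V34 + L34 + Hölder/Sobolev/Young)
  have hstrS : ∀ s ∈ Icc 0 T'',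
      2 * ∫ x, ⟪curl (u s) x, fderiv ℝ (u s) x (curl (u s) x)⟫ ≤
        ν * (∫ x, frobeniusNormSq (fderiv ℝ (curl (u s)) x)) +
          a / (T - s) * (∫ x, ‖curl (u s) x‖ ^ 2) + 0 * (T - s) ^ (-(0 : ℝ)) := by
    intro s hs
    have hsT : s ∈ Ico 0 T := ⟨hs.1, hs.2.trans_lt hT''T⟩
    have hTs : 0 < T - s := by linarith [hsT.2]
    obtain ⟨hv3, hdiv, i0, i1, i2, hB₁, hB₂⟩ := hpk s hs
    have hv2 : ContDiff ℝ 2 (u s) := hv3.of_le (by norm_cast)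
    have hvc : Continuous (u s) := hv2.continuous
    have hωc : Continuous (curl (u s)) := continuous_curl (hv2.of_le (by norm_num))
    have hL : 0 < ε₀ / (T - s) := div_pos hε₀ hTs
    have hmain := two_mul_integral_stretching_le_lamb hV hη hC hL hv2 hdiv i0 i1 i2 hB₂ hB₁
    set D : ℝ := ∫ x, frobeniusNormSq (fderiv ℝ (curl (u s)) x) with hD
    set Y : ℝ := ∫ x, ‖curl (u s) x‖ ^ 2 with hY
    set Gv : ℝ := ∫ x, ‖fderiv ℝ (u s) x‖ ^ 2 with hGv
    set Λ : ℝ := ∫ x in {x | ε₀ / (T - s) < ‖curl (u s) x‖}, ‖cross (u s x) (curl (u s) x)‖ ^ 2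
      with hΛ
    have hD0 : 0 ≤ D := integral_nonneg fun x => frobeniusNormSq_nonneg _
    have hY0 : 0 ≤ Y := integral_nonneg fun x => sq_nonneg _
    have hGv0 : 0 ≤ Gv := integral_nonneg fun x => sq_nonneg _
    -- the radius `m = ε₃ √(ν/(T−s))`
    set m : ℝ := ε₃ * Real.sqrt (ν / (T - s)) with hmdef
    have hm0 : 0 ≤ m := by positivity
    have hm2 : m ^ 2 = ε₃ ^ 2 * (ν / (T - s)) := by
      rw [hmdef, mul_pow, Real.sq_sqrt (div_nonneg hν.le hTs.le)]
    -- the door hypothesis at time `s`, as `∫_S X³ ≤ m³`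
    have h3 : ∫ x in {x | ε₀ / (T - s) < ‖curl (u s) x‖},
        (‖cross (u s x) (curl (u s) x)‖ / ‖u s x‖) ^ 3 ≤ m ^ 3 := by
      have hset : {x | ε₀ / (T - s) < ‖curl (u s) x‖} = {x | ε₀ < (T - s) * ‖curl (u s) x‖} := by
        ext x
        simp only [mem_setOf_eq]
        rw [div_lt_iff₀ hTs, mul_comm]
      rw [hset]
      exact setIntegral_pow_three_le_of_lintegral_le
        ((crossCLM.continuous₂.comp₂ hvc hωc).norm.measurable.div hvc.norm.measurable)
        (fun x => (twist_density_basic (u s x) (curl (u s) x)).1) (htw s hsT) (by positivity)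
    have hΛle : Λ ≤ (m * K₆) ^ 2 * Gv :=
      setIntegral_cross_sq_le_of_twist hv2 i0 i1 hB₂ hB₁ (hB₀ s hs) hL hm0 h3
    -- `∫‖∇u‖²_op ≤ ∫|∇u|²_F ≤ ∫|ω|²`
    have Ifv : Integrable fun x => frobeniusNormSq (fderiv ℝ (u s) x) := by
      refine (i1.const_mul 3).mono'
        (continuous_frobeniusNormSq_fderiv hv2 (by norm_num)).aestronglyMeasurable
        (Eventually.of_forall fun x => ?_)
      rw [Real.norm_of_nonneg (frobeniusNormSq_nonneg _)]
      exact frobeniusNormSq_le_three_mul _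
    have Iω : Integrable fun x => ‖curl (u s) x‖ ^ 2 := by
      refine (i1.const_mul (‖curlCLM‖ ^ 2)).mono' ((hωc.norm.pow 2).aestronglyMeasurable)
        (Eventually.of_forall fun x => ?_)
      rw [Real.norm_of_nonneg (sq_nonneg _), ← mul_pow]
      exact pow_le_pow_left₀ (norm_nonneg _) (norm_curl_le (u s) x) 2
    have hFY : ∫ x, frobeniusNormSq (fderiv ℝ (u s) x) ≤ Y := by
      have h := lintegral_frobeniusNormSq_fderiv_le_lintegral_sq_norm_curl hv2 hdiv
        (lintegral_enorm_sq_lt_top_of_integrable_sq i0)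
      have hFl : ENNReal.ofReal (∫ x, frobeniusNormSq (fderiv ℝ (u s) x)) =
          ∫⁻ x, ENNReal.ofReal (frobeniusNormSq (fderiv ℝ (u s) x)) :=
        ofReal_integral_eq_lintegral_ofReal Ifv
          (Eventually.of_forall fun x => frobeniusNormSq_nonneg _)
      have hYl : ∫⁻ x, ‖curl (u s) x‖ₑ ^ 2 = ENNReal.ofReal Y := by
        rw [hY, ofReal_integral_eq_lintegral_ofReal Iω (Eventually.of_forall fun x => sq_nonneg _)]
        refine lintegral_congr fun x => ?_
        rw [ENNReal.ofReal_pow (norm_nonneg _), ofReal_norm]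
      rw [← hFl, hYl] at h
      exact (ENNReal.ofReal_le_ofReal_iff hY0).1 h
    have hGF : Gv ≤ ∫ x, frobeniusNormSq (fderiv ℝ (u s) x) :=
      integral_mono i1 Ifv fun x => sq_opNorm_le_frobeniusNormSq _
    have hGY : Gv ≤ Y := hGF.trans hFY
    have hΛY : Λ ≤ (m * K₆) ^ 2 * Y := hΛle.trans (mul_le_mul_of_nonneg_left hGY (sq_nonneg _))
    -- Young: `C √D √Λ ≤ ν D + (k²/4)(T−s)^{-1} Y`
    have hsqrtΛ : Real.sqrt Λ ≤ m * K₆ * Real.sqrt Y := by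
      calc Real.sqrt Λ ≤ Real.sqrt ((m * K₆) ^ 2 * Y) := Real.sqrt_le_sqrt hΛY
        _ = m * K₆ * Real.sqrt Y := by
            rw [Real.sqrt_mul (sq_nonneg _), Real.sqrt_sq (by positivity)]
    set P : ℝ := Real.sqrt D with hPdef
    set Q : ℝ := Real.sqrt Y with hQdef
    have hP0 : 0 ≤ P := Real.sqrt_nonneg _
    have hQ0 : 0 ≤ Q := Real.sqrt_nonneg _
    have hPP : P * P = D := Real.mul_self_sqrt hD0
    have hQQ : Q * Q = Y := Real.mul_self_sqrt hY0
    have habs : C * P * Real.sqrt Λ ≤ ν * D + k ^ 2 / 4 / (T - s) * Y := by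
      have h1 : C * P * Real.sqrt Λ ≤ C * P * (m * K₆ * Q) :=
        mul_le_mul_of_nonneg_left hsqrtΛ (by positivity)
      have h2 : C * P * (m * K₆ * Q) = k * Real.sqrt (ν / (T - s)) * P * Q := by
        rw [hmdef, hkdef]; ring
      have hr2 : Real.sqrt (ν / (T - s)) * Real.sqrt (ν / (T - s)) = ν / (T - s) :=
        Real.mul_self_sqrt (div_nonneg hν.le hTs.le)
      calc C * P * Real.sqrt Λ ≤ C * P * (m * K₆ * Q) := h1
        _ = k * Real.sqrt (ν / (T - s)) * P * Q := h2
        _ ≤ ν * (P * P) + k ^ 2 / 4 / (T - s) * (Q * Q) := young_twist hν hTs hr2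
        _ = ν * D + k ^ 2 / 4 / (T - s) * Y := by rw [hPP, hQQ]
    have hcoef : 2 / Real.sqrt 3 * ((1 + η) * (ε₀ / (T - s))) = a₀ / (T - s) := by
      rw [ha₀def]
      ring
    have hsum : a₀ / (T - s) * Y + k ^ 2 / 4 / (T - s) * Y = a / (T - s) * Y := by
      rw [hadef]; ring
    calc 2 * ∫ x, ⟪curl (u s) x, fderiv ℝ (u s) x (curl (u s) x)⟫
        ≤ 2 / Real.sqrt 3 * ((1 + η) * (ε₀ / (T - s))) * Y + C * P * Real.sqrt Λ := hmain
      _ ≤ a₀ / (T - s) * Y + (ν * D + k ^ 2 / 4 / (T - s) * Y) := by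
          rw [hcoef]; exact add_le_add le_rfl habs
      _ = ν * D + a / (T - s) * Y + 0 * (T - s) ^ (-(0 : ℝ)) := by rw [← hsum]; ring
  -- the forced power Grönwall inequality on the slab (`β = 0`, `c = 0`)
  have hYt := hGr ν T T'' a 0 0 hν hT''pos hT''T ha_nonneg le_rfl (by linarith) u p hS hB hstrS t
    htS
  rw [zero_mul, zero_div, add_zero] at hYt
  -- `∫⁻|∇u|²_F ≤ ∫|ω|²`
  obtain ⟨hv3, hdiv, i0, i1, -, -, -⟩ := hpk t htS
  have hYint : Integrable fun x => ‖curl (u t) x‖ ^ 2 := by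
    refine (i1.const_mul (‖curlCLM‖ ^ 2)).mono'
      (((continuous_curl (hv3.of_le (by norm_cast))).norm.pow 2).aestronglyMeasurable)
      (Eventually.of_forall fun x => ?_)
    rw [Real.norm_of_nonneg (sq_nonneg _), ← mul_pow]
    exact pow_le_pow_left₀ (norm_nonneg _) (norm_curl_le (u t) x) 2
  exact lintegral_frobeniusNormSq_le_of_integral_curl_sq_le (hv3.of_le (by norm_cast)) hdiv i0 hYint
    hYt

/-- **Plate A34-D «CriticalTwistPowerBoundAssembly» PROVED**: `ValueCutoffLowStretching →
LambPairingBound → ForcedPowerGronwallSlab → CriticalTwistPowerBound`. Given `ε₀`: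
`η := (√3/(4ε₀) − 1)/2`, `a₀ := (2/√3)(1+η)ε₀`, `C := C_η` from L34,
`ε₃ := √(1/2 − a₀)/(C K₆ + 1)` (depends on `ε₀` only); then time translation and
`criticalTwistPowerBound_zero` (`CriticalTwist` translates since `T − t = (T − t₀) − (t − t₀)`).
[folklore] -/
theorem criticalTwistPowerBoundAssembly_holds : CriticalTwistPowerBoundAssembly := by
  intro hV hL hGr ε₀ hε₀ hε₀'
  set K₆ : ℝ := (SNormLESNormFDerivOfEqConst (EuclideanSpace ℝ (Fin 3))
    (volume : Measure (EuclideanSpace ℝ (Fin 3))) 2 : ℝ) with hK₆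
  have hK₆0 : 0 ≤ K₆ := NNReal.coe_nonneg _
  obtain ⟨hη, -, ha0⟩ := exponent_of_lt_sqrt_three_div_four hε₀ hε₀'
  obtain ⟨C, hC0, hC⟩ := hL _ hη
  set a₀ : ℝ := 2 / Real.sqrt 3 * (1 + (Real.sqrt 3 / (4 * ε₀) - 1) / 2) * ε₀ with ha₀def
  have hgap : 0 < 1 / 2 - a₀ := by rw [ha₀def]; linarith
  set ε₃ : ℝ := Real.sqrt (1 / 2 - a₀) / (C * K₆ + 1) with hε₃def
  have hε₃ : 0 < ε₃ := div_pos (Real.sqrt_pos.2 hgap) (by positivity)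
  refine ⟨ε₃, hε₃, ?_⟩
  intro ν T t₀ hν ht₀ ht₀T u p hsol hreg htw
  have hsmall : (C * K₆ * ε₃) ^ 2 ≤ 1 / 2 - a₀ := by
    have hq : C * K₆ / (C * K₆ + 1) ≤ 1 := by
      rw [div_le_one (by positivity)]; linarith
    have hq0 : 0 ≤ C * K₆ / (C * K₆ + 1) := by positivity
    have hkε : C * K₆ * ε₃ = C * K₆ / (C * K₆ + 1) * Real.sqrt (1 / 2 - a₀) := by
      rw [hε₃def]; ring
    rw [hkε, mul_pow, Real.sq_sqrt hgap.le]
    calc (C * K₆ / (C * K₆ + 1)) ^ 2 * (1 / 2 - a₀) ≤ 1 * (1 / 2 - a₀) := by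
          refine mul_le_mul_of_nonneg_right ?_ hgap.le
          calc (C * K₆ / (C * K₆ + 1)) ^ 2 ≤ 1 ^ 2 := pow_le_pow_left₀ hq0 hq 2
            _ = 1 := one_pow 2
      _ = 1 / 2 - a₀ := one_mul _
  have hTt : 0 < T - t₀ := by linarith
  have hsol' : IsClassicalNSSolutionOn (Ico 0 (T - t₀)) ν 0 (fun t => u (t + t₀))
      (fun t => p (t + t₀)) := hsol.translate_Ico_zero ht₀
  have hreg' : ∀ T'' < T - t₀, HasBoundedSobolevNormsOn (Icc 0 T'') (fun t => u (t + t₀)) := by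
    intro T'' hT'' n
    obtain ⟨C', hC'⟩ := hreg (T'' + t₀) (by linarith) n
    exact ⟨C', fun t ht => hC' (t + t₀) ⟨by linarith [ht.1], by linarith [ht.2]⟩⟩
  have htw' : CriticalTwist (fun t => u (t + t₀)) ν (T - t₀) 0 ε₀ ε₃ := by
    intro t ht
    have h := htw (t + t₀) ⟨by linarith [ht.1], by linarith [ht.2]⟩
    have hTT : T - (t + t₀) = T - t₀ - t := by ring
    simp only [hTT] at h
    exact h
  obtain ⟨K, a, hK0, ha, hF⟩ := criticalTwistPowerBound_zero hV hGr hν hTt hε₀ hε₀' hε₃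
    hC0 hC hsmall hsol' hreg' htw'
  refine ⟨K, a, hK0, ha, fun t ht => ?_⟩
  have h := hF (t - t₀) ⟨by linarith [ht.1], by linarith [ht.2]⟩
  have hTT : T - t₀ - (t - t₀) = T - t := by ring
  simp only [sub_add_cancel, hTT] at h
  exact h

end Summit.NavierStokesRegularity.NavierStokesRegularity.Theorems.IntenseSetDoors

end
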